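import Summits.CriticalPhenomena.PercolationContinuityZ3.Theorems.Transplant.CayleyZ2RotC4SideOn
import Summits.CriticalPhenomena.PercolationContinuityZ3.Theorems.Transplant.PlanarSkeletonFrmScaledDefs
import HarnessLib

/-!
# The rotor square lattice `X = Cay(ℤ² ⋊ C₄; ρ, x)` carries NO single-edge-step chart AT ALL — an automorphism-free obstruction: `X` is outside EVERY planar-skeleton
# carrier of the tree (any frames, any scale `N`, any number of types), although `X □ ℤ` (p4 gen 19, side-on) and `X ≤ X′ = ℤ² □ C₄` (p492866) are customers

builds on p205010 (kernel theorem, internal audit signed; external expert review pending) — NOTHING in this file uses p205010: a finite combinatorial NO-GO, unconditional, std axioms.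
Lane `prim-bschramm`, seat `prim-bschramm-p5` gen 27 (refuter / sharpness seat; P5-SHARPNESS §59.2).  Helper file (`--supports stmt-CriticalPhenomena-4575 --as helper`); no node, no
statement, no `@[conjecture]`; nothing is claimed about `θ(p_c)` of `X` itself (OPEN here; not claimed in print to this desk's knowledge).

WHAT.  `X = Z2Rot.graph` («CayleyZ2RotC4SideOn»): vertices `(v, k) ∈ ℤ² × ℤ/4` (position, heading), bonds `(v,k) ∼ (v ± ρ^k e₀, k)` (move) and `(v,k) ∼ (v, k ± 1)` (turn); 4-regular,
vertex-transitive (a Cayley graph of the `b₁ = 0` group `ℤ² ⋊ C₄`).  Every carrier of the skeleton ladder (`PlanarSkeletonConc/Sign/Neg/Frm/FrmFrom/FrmScaled`) has the field (ι):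
at EVERY vertex and for EACH of the four displacements `± N e₀, ± N e₁` a NEIGHBOUR realising it (single edge).  **`Z2Rot.no_singleEdgeStep_chart`: for every `N ≠ 0` there is NO map
`φ : V(X) → ℤ²` with that property** — no frames, no Lipschitz bound, no equivariance assumed; hence `IsEmpty (PlanarSkeletonFrmScaled X)` and `IsEmpty (PlanarSkeletonFrmFrom X)`
(`Z2Rot.isEmpty_frmScaled / isEmpty_frmFrom`).  This is the degree-4 witness of the class map after the orbit theorem (p3 g28 «AutChartOrbitsCriticalContinuity» p493117, hypothesis
`hstep`): the single-edge step hypothesis cannot be removed by ANY choice of chart or symmetry group on `X` (the degree-3 witnesses — honeycomb, subdivided `ℤ²` — are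
«PlanarSkeletonMinDegree» / «PlanarSkeletonStepObstruction»).  It REPLACES P3-NILPOTENT §20.3 (w2), whose graph `Cay(ℤ²⋊C₄; ρ, τρ)` is the square lattice itself (bus 2026-08-27 04:00Z).
PROOF (automorphism-free).  Degree 4 forces the four neighbours of each vertex to realise the four displacements BIJECTIVELY (`exists_code`: pigeonhole in the 4-set `Z2Rot.nbrs v`).  Read the
displacements as codes `j : Fin 4` (`N • dir j`).  At position `x` the turn 4-cycle `(x,0),(x,1),(x,2),(x,3)` has turn codes `c₀..c₃` with `Σ dir cₖ = 0` (telescoping) and `c_{k+1} ≠ c_k + 2`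
(the two turn-neighbours of `(x,k+1)` carry distinct displacements) — so it is a unit SQUARE: `c₂ = c₀ + 2`, `c₃ = c₁ + 2`, `c₁ ⊥ c₀` (`square_codes`, `decide`).  The position `x + e₀` is entered
from `(x,0)` by a `+`move (code `m ∉ {c₀, c₃+2}`) and from the OPPOSITE corner `(x,2)` by a `−`move (`ρ² e₀ = −e₀`; code `m′ ∉ {c₂, c₁+2}`); comparing `φ(x+e₀,2) − φ(x+e₀,0)` along the two
routes with the turn square at `x + e₀` gives `dir c₀ + dir c₁ + dir m′ = dir m + dir c₀′ + dir c₁′`, which has no solution (`noChart_codes`, `decide` over `4⁶` cases).  Machine cross-check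
(desk): no locally-bijective chart exists on the radius-3 ball of `X` (40 vertices, exhaustive); the radius-2 ball still admits one.
[cite: BenjaminiSchramm1996, Conj. 4; §2 (Cayley graphs)] [cite: KozmaNitzan2024, §4 p. 16 (Lemma 8: the lattice symmetries)] [this work]
-/

noncomputable section

namespace Summit.CriticalPhenomena.PercolationContinuityZ3.Theorems.Transplant

open Literature.Probability.LatticeModels SimpleGraph
open scoped Classical

namespace Z2Rot

/-! ## §1 Codes: the four displacements `N • dir j`, `j : Fin 4` -/

/-- The displacement codes as integer pairs (for `decide`): `(1,0), (0,1), (−1,0), (0,−1)`. [folklore] -/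
def dv : Fin 4 → ℤ × ℤ := ![(1, 0), (0, 1), (-1, 0), (0, -1)]

/-- `dir j` has coordinates `dv j`. [folklore] -/
theorem dir_apply (j : Fin 4) : dir j 0 = (dv j).1 ∧ dir j 1 = (dv j).2 := by
  fin_cases j <;> simp [dir, dv]

/-- Heading vectors determine the heading (`Z2Rot.dir` is one-to-one on `Fin 4`). [folklore] -/
theorem eq_of_dir_eq {j j' : Fin 4} (h : dir j = dir j') : j = j' := by
  have h0 := congrFun h 0
  have h1 := congrFun h 1
  rw [(dir_apply j).1, (dir_apply j').1] at h0
  rw [(dir_apply j).2, (dir_apply j').2] at h1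
  revert h0 h1
  fin_cases j <;> fin_cases j' <;> simp [dv]

/-- Scaled displacements are injective in the code (`N ≠ 0`). [folklore] -/
theorem smul_dir_injective {N : ℤ} (hN : N ≠ 0) {j j' : Fin 4} (h : N • dir j = N • dir j') : j = j' :=
  eq_of_dir_eq (smul_right_injective (Site 2) hN h)

/-- Every axis displacement `Pi.single i (N σ)` is `N • dir j` for some code `j`. [folklore] -/
theorem exists_code_single (N : ℤ) (i : Fin 2) (σ : ℤˣ) : ∃ j : Fin 4, Pi.single i (N * (σ : ℤ)) = N • dir j := by
  rcases Int.units_eq_one_or σ with rfl | rfl <;> fin_cases i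
  · exact ⟨0, by ext t; fin_cases t <;> simp [dir]⟩
  · exact ⟨1, by ext t; fin_cases t <;> simp [dir]⟩
  · exact ⟨2, by ext t; fin_cases t <;> simp [dir]⟩
  · exact ⟨3, by ext t; fin_cases t <;> simp [dir]⟩

/-- Conversely every code is an axis displacement. [folklore] -/
theorem exists_single_code (N : ℤ) (j : Fin 4) : ∃ (i : Fin 2) (σ : ℤˣ), Pi.single i (N * (σ : ℤ)) = N • dir j := by
  fin_cases j
  · exact ⟨0, 1, by ext t; fin_cases t <;> simp [dir]⟩
  · exact ⟨1, 1, by ext t; fin_cases t <;> simp [dir]⟩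
  · exact ⟨0, -1, by ext t; fin_cases t <;> simp [dir]⟩
  · exact ⟨1, -1, by ext t; fin_cases t <;> simp [dir]⟩

/-- The candidate set has at most four elements. [folklore] -/
theorem card_nbrs_le (a : Vtx) : (nbrs a).card ≤ 4 := by
  unfold nbrs
  refine (Finset.card_insert_le _ _).trans (Nat.succ_le_succ ?_)
  refine (Finset.card_insert_le _ _).trans (Nat.succ_le_succ ?_)
  refine (Finset.card_insert_le _ _).trans (Nat.succ_le_succ ?_)
  rw [Finset.card_singleton]

/-! ## §2 Local bijectivity: on a 4-regular graph the four displacements exhaust the neighbours -/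

/-- **LOCAL BIJECTIVITY.**  If at `v` every displacement `N • dir j` (`N ≠ 0`) is realised by a neighbour, then EVERY candidate neighbour `u ∈ nbrs v` carries a code `g u` with
`φ u = φ v + N • dir (g u)`, and distinct candidates carry distinct codes (pigeonhole in the 4-set `nbrs v`). [this work] -/
theorem exists_code {N : ℤ} (hN : N ≠ 0) (φ : Vtx → Site 2) (v : Vtx) (hstep : ∀ j : Fin 4, ∃ u : Vtx, graph.Adj v u ∧ φ u = φ v + N • dir j) :
    ∃ g : Vtx → Fin 4, (∀ u ∈ nbrs v, φ u = φ v + N • dir (g u)) ∧ (∀ u ∈ nbrs v, ∀ u' ∈ nbrs v, u ≠ u' → g u ≠ g u') := by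
  choose f hadj hφ using hstep
  have hinj : Function.Injective f := by
    intro j j' h
    have e : N • dir j = N • dir j' := by
      have := hφ j
      rw [h, hφ j'] at this
      exact (add_left_cancel this).symm
    exact smul_dir_injective hN e
  set S : Finset Vtx := Finset.univ.image f with hS
  have hScard : S.card = 4 := by
    rw [hS, Finset.card_image_of_injective _ hinj, Finset.card_univ, Fintype.card_fin]
  have hSsub : S ⊆ nbrs v := by
    intro u hu
    rw [hS, Finset.mem_image] at hu
    obtain ⟨j, -, rfl⟩ := hu
    exact mem_nbrs_of_adj (hadj j)
  have hSeq : S = nbrs v := Finset.eq_of_subset_of_card_le hSsub (by rw [hScard]; exact card_nbrs_le v)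
  -- the code of a candidate: the preimage under `f`
  have hpre : ∀ u ∈ nbrs v, ∃ j, f j = u := by
    intro u hu
    rw [← hSeq, hS, Finset.mem_image] at hu
    obtain ⟨j, -, hj⟩ := hu
    exact ⟨j, hj⟩
  refine ⟨fun u => if h : u ∈ nbrs v then (hpre u h).choose else 0, fun u hu => ?_, fun u hu u' hu' hne => ?_⟩
  · have hj := (hpre u hu).choose_spec
    simp only [dif_pos hu]
    conv_lhs => rw [← hj]
    exact hφ _
  · simp only [dif_pos hu, dif_pos hu']
    intro h
    apply hne
    rw [← (hpre u hu).choose_spec, ← (hpre u' hu').choose_spec, h]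

/-! ## §3 The combinatorics of codes (finite, by `decide`) -/

/-- **The turn square.**  Four codes with displacement sum `0` and no immediate reversal (`c_{k+1} ≠ c_k + 2`) form a unit square: opposite sides are opposite, adjacent sides
perpendicular. [this work] -/
theorem square_codes : ∀ c₀ c₁ c₂ c₃ : Fin 4,
    dv c₀ + dv c₁ + dv c₂ + dv c₃ = 0 → c₁ ≠ c₀ + 2 → c₂ ≠ c₁ + 2 → c₃ ≠ c₂ + 2 → c₀ ≠ c₃ + 2 →
      c₂ = c₀ + 2 ∧ c₃ = c₁ + 2 ∧ (c₁ = c₀ + 1 ∨ c₁ = c₀ + 3) := by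
  decide

/-- **The final clash.**  With the turn squares at `x` (codes `c₀ ⊥ c₁`) and at `x + e₀` (`c₀′ ⊥ c₁′`), a `+`move out of corner `0` (code `m ∉ {c₀, c₁}`) and a `−`move out of the opposite
corner `2` (code `m′ ∉ {c₀+2, c₁+2}`) cannot land on the same turn square: `dv c₀ + dv c₁ + dv m′ ≠ dv m + dv c₀′ + dv c₁′`. [this work] -/
theorem noChart_codes : ∀ c₀ c₁ c₀' c₁' m m' : Fin 4,
    (c₁ = c₀ + 1 ∨ c₁ = c₀ + 3) → (c₁' = c₀' + 1 ∨ c₁' = c₀' + 3) → m ≠ c₀ → m ≠ c₁ → m' ≠ c₀ + 2 → m' ≠ c₁ + 2 →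
      dv c₀ + dv c₁ + dv m' ≠ dv m + dv c₀' + dv c₁' := by
  decide

/-- Transfer of the telescoping identity. [folklore] -/
theorem dv_sum_eq_zero_of_dir {a b c d : Fin 4} (h : dir a + dir b + dir c + dir d = 0) : dv a + dv b + dv c + dv d = 0 := by
  have h0 := congrFun h 0
  have h1 := congrFun h 1
  simp only [Pi.add_apply, Pi.zero_apply, (dir_apply _).1, (dir_apply _).2] at h0 h1
  exact Prod.ext (by simpa using h0) (by simpa using h1)

/-- Opposite displacements have opposite codes. [folklore] -/
theorem code_neg {N : ℤ} (hN : N ≠ 0) {j j' : Fin 4} (h : N • dir j' = -(N • dir j)) : j' = j + 2 := by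
  have e : N • dir j' = N • dir (j + 2) := by
    rw [h, ← smul_neg]
    congr 1
    fin_cases j <;> (ext t; fin_cases t <;> simp [dir])
  exact smul_dir_injective hN e

/-! ## §4 The theorem -/

/-- **THE ROTOR SQUARE LATTICE HAS NO SINGLE-EDGE-STEP CHART** (automorphism-free): for `N ≠ 0` there is no `φ : V(X) → ℤ²` such that every vertex has, for each of the four displacements
`± N e₀, ± N e₁`, a NEIGHBOUR realising it. [this work] -/
theorem no_singleEdgeStep_chart (N : ℤ) (hN : N ≠ 0) (φ : Vtx → Site 2)
    (hstep : ∀ (v : Vtx) (i : Fin 2) (σ : ℤˣ), ∃ v' : Vtx, graph.Adj v v' ∧ φ v' = φ v + Pi.single i (N * (σ : ℤ))) : False := by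
  -- steps in code form
  have hstep' : ∀ (v : Vtx) (j : Fin 4), ∃ u : Vtx, graph.Adj v u ∧ φ u = φ v + N • dir j := by
    intro v j
    obtain ⟨i, σ, hiσ⟩ := exists_single_code N j
    obtain ⟨u, hu, hφ⟩ := hstep v i σ
    exact ⟨u, hu, by rw [hφ, hiσ]⟩
  -- membership of the explicit neighbours in the candidate sets
  have memP : ∀ (v : Site 2) (k : Fin 4), ((v + dir k, k) : Vtx) ∈ nbrs (v, k) := fun v k => by simp [nbrs]
  have memM : ∀ (v : Site 2) (k : Fin 4), ((v - dir k, k) : Vtx) ∈ nbrs (v, k) := fun v k => by simp [nbrs]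
  have memT : ∀ (v : Site 2) (k : Fin 4), ((v, k + 1) : Vtx) ∈ nbrs (v, k) := fun v k => by simp [nbrs]
  have memT' : ∀ (v : Site 2) (k : Fin 4), ((v, k - 1) : Vtx) ∈ nbrs (v, k) := fun v k => by simp [nbrs]
  -- distinctness of the explicit neighbours we compare
  have neTT' : ∀ (v : Site 2) (k : Fin 4), ((v, k + 1) : Vtx) ≠ (v, k - 1) := fun v k h => by
    have h2 : k + 1 = k - 1 := congrArg Prod.snd h
    revert h2; fin_cases k <;> decide
  have nePT : ∀ (v : Site 2) (k : Fin 4), ((v + dir k, k) : Vtx) ≠ (v, k + 1) := fun v k h => by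
    have h2 : k = k + 1 := congrArg Prod.snd h
    revert h2; fin_cases k <;> decide
  have nePT' : ∀ (v : Site 2) (k : Fin 4), ((v + dir k, k) : Vtx) ≠ (v, k - 1) := fun v k h => by
    have h2 : k = k - 1 := congrArg Prod.snd h
    revert h2; fin_cases k <;> decide
  have neMT : ∀ (v : Site 2) (k : Fin 4), ((v - dir k, k) : Vtx) ≠ (v, k + 1) := fun v k h => by
    have h2 : k = k + 1 := congrArg Prod.snd h
    revert h2; fin_cases k <;> decide
  have neMT' : ∀ (v : Site 2) (k : Fin 4), ((v - dir k, k) : Vtx) ≠ (v, k - 1) := fun v k h => by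
    have h2 : k = k - 1 := congrArg Prod.snd h
    revert h2; fin_cases k <;> decide
  -- turn codes along a turn cycle at position `x`, with the square relations
  have square : ∀ x : Site 2, ∃ c : Fin 4 → Fin 4,
      (∀ k, φ (x, k + 1) = φ (x, k) + N • dir (c k)) ∧ c 2 = c 0 + 2 ∧ c 3 = c 1 + 2 ∧ (c 1 = c 0 + 1 ∨ c 1 = c 0 + 3) ∧
      (∀ k, ∀ u ∈ nbrs (x, k), u ≠ (x, k + 1) → u ≠ (x, k - 1) → ∃ j, φ u = φ (x, k) + N • dir j ∧ j ≠ c k ∧ j ≠ c (k - 1) + 2) := by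
    intro x
    have hg : ∀ k : Fin 4, ∃ g : Vtx → Fin 4, (∀ u ∈ nbrs (x, k), φ u = φ (x, k) + N • dir (g u)) ∧
        (∀ u ∈ nbrs (x, k), ∀ u' ∈ nbrs (x, k), u ≠ u' → g u ≠ g u') := fun k => exists_code hN φ (x, k) (hstep' (x, k))
    choose g hgφ hgne using hg
    refine ⟨fun k => g k (x, k + 1), fun k => hgφ k _ (memT x k), ?_⟩
    -- the code of the backward turn at `(x, k+1)` is the opposite of `c k`
    have hback : ∀ k : Fin 4, g (k + 1) (x, k) = g k (x, k + 1) + 2 := by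
      intro k
      have h1 := hgφ k _ (memT x k)
      have hm : ((x, k) : Vtx) ∈ nbrs (x, k + 1) := by
        have := memT' x (k + 1); rwa [add_sub_cancel_right] at this
      have h2 := hgφ (k + 1) _ hm
      refine code_neg hN ?_
      have : φ (x, k) = φ (x, k) + N • dir (g k (x, k + 1)) + N • dir (g (k + 1) (x, k)) := by
        conv_lhs => rw [h2, h1]
      have e : N • dir (g k (x, k + 1)) + N • dir (g (k + 1) (x, k)) = 0 := by
        have := this.symm; rw [add_assoc] at this; exact add_left_cancel (a := φ (x, k)) (by rw [this, add_zero])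
      exact eq_neg_of_add_eq_zero_right e
    -- no immediate reversal: the two turn-neighbours of `(x, k+1)` carry distinct codes
    have hnorev : ∀ k : Fin 4, g (k + 1) (x, k + 1 + 1) ≠ g k (x, k + 1) + 2 := by
      intro k
      rw [← hback k]
      have hm : ((x, k) : Vtx) ∈ nbrs (x, k + 1) := by
        have := memT' x (k + 1); rwa [add_sub_cancel_right] at this
      refine hgne (k + 1) _ (memT x (k + 1)) _ hm ?_
      have := neTT' x (k + 1); rwa [add_sub_cancel_right] at this
    -- telescoping around the cycle
    have htel : dir (g 0 (x, 0 + 1)) + dir (g 1 (x, 1 + 1)) + dir (g 2 (x, 2 + 1)) + dir (g 3 (x, 3 + 1)) = 0 := by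
      have h0 := hgφ 0 _ (memT x 0)
      have h1 := hgφ 1 _ (memT x 1)
      have h2 := hgφ 2 _ (memT x 2)
      have h3 := hgφ 3 _ (memT x 3)
      have e3 : ((x, (3 : Fin 4) + 1) : Vtx) = (x, 0) := rfl
      have e2 : ((x, (2 : Fin 4) + 1) : Vtx) = (x, 3) := rfl
      have e1 : ((x, (1 : Fin 4) + 1) : Vtx) = (x, 2) := rfl
      have e0 : ((x, (0 : Fin 4) + 1) : Vtx) = (x, 1) := rfl
      rw [e3] at h3; rw [e2] at h2; rw [e1] at h1; rw [e0] at h0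
      have : φ (x, 0) = φ (x, 0) + (N • dir (g 0 (x, 0 + 1)) + N • dir (g 1 (x, 1 + 1)) + N • dir (g 2 (x, 2 + 1)) + N • dir (g 3 (x, 3 + 1))) := by
        conv_lhs => rw [h3, h2, h1, h0]
        simp only [e0, e1, e2, e3]
        abel
      have hsum : N • dir (g 0 (x, 0 + 1)) + N • dir (g 1 (x, 1 + 1)) + N • dir (g 2 (x, 2 + 1)) + N • dir (g 3 (x, 3 + 1)) = 0 :=
        add_left_cancel (a := φ (x, 0)) (by rw [← this, add_zero])
      have hsum' : N • (dir (g 0 (x, 0 + 1)) + dir (g 1 (x, 1 + 1)) + dir (g 2 (x, 2 + 1)) + dir (g 3 (x, 3 + 1))) = 0 := by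
        simpa only [smul_add] using hsum
      exact (smul_eq_zero.1 hsum').resolve_left hN
    have hsq := square_codes (g 0 (x, 0 + 1)) (g 1 (x, 1 + 1)) (g 2 (x, 2 + 1)) (g 3 (x, 3 + 1)) (dv_sum_eq_zero_of_dir htel)
      (hnorev 0) (hnorev 1) (hnorev 2) (by have := hnorev 3; exact this)
    refine ⟨hsq.1, hsq.2.1, hsq.2.2, fun k u hu hne1 hne2 => ⟨g k u, hgφ k u hu, ?_, ?_⟩⟩
    · exact hgne k u hu _ (memT x k) hne1
    · rw [← hback]
      have e : k - 1 + 1 = k := sub_add_cancel k 1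
      rw [e]
      exact hgne k u hu _ (memT' x k) hne2
  -- the two positions `x := 0` and `x' := e₀ = dir 0`
  obtain ⟨c, hc, hc2, hc3, hc1, hmove⟩ := square 0
  obtain ⟨c', hc', -, -, hc1', -⟩ := square (dir 0)
  -- the `+`move out of corner `0`: `(0,0) → (dir 0, 0)`
  obtain ⟨m, hm, hm1, hm2⟩ := hmove 0 (0 + dir 0, 0) (memP 0 0) (nePT 0 0) (nePT' 0 0)
  -- the `−`move out of corner `2`: `(0,2) → (0 - dir 2, 2) = (dir 0, 2)`
  obtain ⟨m', hm', hm1', hm2'⟩ := hmove 2 (0 - dir 2, 2) (memM 0 2) (neMT 0 2) (neMT' 0 2)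
  have e02 : ((0 : Site 2) - dir 2, (2 : Fin 4)) = ((dir 0 : Site 2), 2) := by
    refine Prod.ext ?_ rfl
    show (0 : Site 2) - dir 2 = dir 0
    ext t; fin_cases t <;> simp [dir]
  have e00 : ((0 : Site 2) + dir 0, (0 : Fin 4)) = ((dir 0 : Site 2), 0) := by rw [zero_add]
  rw [e02] at hm'
  rw [e00] at hm
  -- two routes from `φ (dir 0, 0)` to `φ (dir 0, 2)`
  have hA : φ ((dir 0 : Site 2), 2) = φ ((dir 0 : Site 2), 0) + N • dir (c' 0) + N • dir (c' 1) := by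
    have h0 := hc' 0
    have h1 := hc' 1
    have e1 : ((dir 0, (1 : Fin 4) + 1) : Vtx) = (dir 0, 2) := rfl
    have e0 : ((dir 0, (0 : Fin 4) + 1) : Vtx) = (dir 0, 1) := rfl
    rw [e1] at h1; rw [e0] at h0
    rw [h1, h0]
  have hB : φ ((dir 0 : Site 2), 2) = φ ((dir 0 : Site 2), 0) - N • dir m + N • dir (c 0) + N • dir (c 1) + N • dir m' := by
    have h0 := hc 0
    have h1 := hc 1
    have e1 : (((0 : Site 2), (1 : Fin 4) + 1) : Vtx) = (0, 2) := rfl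
    have e0 : (((0 : Site 2), (0 : Fin 4) + 1) : Vtx) = (0, 1) := rfl
    rw [e1] at h1; rw [e0] at h0
    rw [hm', h1, h0, hm]
    abel
  have coord : ∀ t : Fin 2, dir (c 0) t + dir (c 1) t + dir m' t = dir m t + dir (c' 0) t + dir (c' 1) t := by
    intro t
    have h := congrFun (hA.symm.trans hB) t
    simp only [Pi.add_apply, Pi.sub_apply, Pi.smul_apply, smul_eq_mul] at h
    have h' : N * (dir (c 0) t + dir (c 1) t + dir m' t - (dir m t + dir (c' 0) t + dir (c' 1) t)) = 0 := by linear_combination -h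
    have := (mul_eq_zero.1 h').resolve_left hN
    linarith
  have key : dv (c 0) + dv (c 1) + dv m' = dv m + dv (c' 0) + dv (c' 1) := by
    have h0 := coord 0
    have h1 := coord 1
    simp only [(dir_apply _).1, (dir_apply _).2] at h0 h1
    exact Prod.ext (by simpa using h0) (by simpa using h1)
  have hm2'' : m ≠ c 1 := by
    have := hm2
    have e : (0 : Fin 4) - 1 = 3 := rfl
    rw [e, hc3] at this
    have e2 : c 1 + 2 + 2 = c 1 := by
      have : (2 : Fin 4) + 2 = 0 := rfl
      rw [add_assoc, this, add_zero]
    rwa [e2] at this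
  have hm1'' : m' ≠ c 0 + 2 := by rw [← hc2]; exact hm1'
  have hm2''' : m' ≠ c 1 + 2 := by
    have := hm2'
    have e : (2 : Fin 4) - 1 = 1 := rfl
    rwa [e] at this
  exact noChart_codes (c 0) (c 1) (c' 0) (c' 1) m m' hc1 hc1' hm1 hm2'' hm1'' hm2''' key

/-- **No scaled planar skeleton on `X`** (any number of types, any frames, any `L`, `N`, `ℓ₀`): the field (ι_N) alone is unsatisfiable. [this work] -/
theorem isEmpty_frmScaled : IsEmpty (PlanarSkeletonFrmScaled graph) :=
  ⟨fun Φ => no_singleEdgeStep_chart (Φ.N : ℤ) (by have := Φ.one_le_N; omega) Φ.φ Φ.step⟩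

/-- **No `PlanarSkeletonFrmFrom` on `X`** (unit steps: `N = 1`). [this work] -/
theorem isEmpty_frmFrom : IsEmpty (PlanarSkeletonFrmFrom graph) :=
  ⟨fun Φ => no_singleEdgeStep_chart 1 one_ne_zero Φ.φ fun v i σ => by
    obtain ⟨v', hv', hφ⟩ := Φ.step v i σ
    exact ⟨v', hv', by rw [hφ, one_mul]⟩⟩

end Z2Rot

end Summit.CriticalPhenomena.PercolationContinuityZ3.Theorems.Transplant
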